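import Summits.ResolutionOfSingularities.ResolutionOfSingularities.Theorems.RadicialJungCleanModelsStubCossartPiltant2019StabilityCriterion
import Literature.AlgebraicGeometry.Resolution.ArithmeticalThreefoldsLocalDescentKummerStableLocalRing
import HarnessLib

/-!
# Equivariant local uniformization from INVARIANT COFINALITY (the two research leaves `hEqT` / `hEqI` of `CleanModels` stub 2
# reduced to local uniformization with invariant new generators)

OURS (decomp-res hand-1 g20; crux `stmt-ResolutionOfSingularities-15917`, stub 2 of `Cruxes/CleanModels/Lines/Sketch.lean` rev 35; leaves
`hEqT`/`hStabLoc` (tame layer, [CoP1] Lemma 9.4 «S is stable by G») and `hEqI`/`hStabIη` (inertia layer, [CoP1] Prop. 9.3), i.e. the named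
`@[conjecture]` claims `CossartPiltant2008_lemma94_kummerCore` / `CossartPiltant2008_prop93`).  A def-free TOOL file continuing
`RadicialJungCleanModelsStubCossartPiltant2019StabilityCriterion.lean` (hand-1 g20 memo §2 (C1)).

Frame (the common frame of `hEqT` and `hEqI` in `cossartPiltant2019ReductionP_of_printed_of_equivariantLU_split`): a base `S`, an ambient
field `E` algebraic over `S` with `S → E` injective, a valuation ring `O_E`, a subfield `M′ ∋ S`, and a subgroup `H` of `S`-automorphisms of
`E` mapping `M′` into itself and `O_E ∩ M′` into `O_E`.  A local uniformization of `M′` is a finite `t ⊆ M′` with `M′ ⊆ Frac S(t)`,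
`S[t] ⊆ O_E` and `S[t]` regular at the centre of `O_E`.

* `valuation_map_eq_one_of_mem_subfield` — for `σ ∈ H` and `s ∈ M′` with `v(s) = 1`: `v(σ s) = 1`;
* `locAtCentre_map_mem_of_generators_of_subfield` — the stability criterion of the companion file with the unit hypothesis discharged
  inside `M′`: if `g ⊆ M′` (and `S ⊆ M′`) and `σ a ∈ (S[g])_𝔪` for every `a ∈ g`, then `σ (S[g])_𝔪 ⊆ (S[g])_𝔪`;
* `exists_finset_displacements` — the displacements `σ a − a` (`σ ∈ Aut_S E`, `a ∈ t`) of a finite `t` lie in a finite set (roots of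
  annihilating polynomials);
* `exists_stableLU_of_invariantCofinality` — **MAIN**: given a local uniformization of `M′`, a finite `e₀ ⊆ O_E ∩ M′`, and INVARIANT
  COFINALITY at `M′` («for every local uniformization `t` and finite `e ⊆ O_E ∩ M′` there is a local uniformization `t′ ⊇ t` whose new
  generators are fixed by `H` and whose local ring contains `e`»), there is a local uniformization of `M′` whose local ring is `H`-STABLE and
  contains `e₀` — simultaneously the conclusion of `hEqT` (no `e₀`) and of `hEqI` (`e₀ = {x₀}`).

So both equivariant leaves of stub 2 follow from ONE cofinality statement in which only INVARIANT elements (elements of the fixed field, i.e.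
of the LOWER field of the layer) are adjoined — the kernel form of the memo's diagnosis «the whole difficulty is to reach regularity
adjoining invariant elements only, i.e. to resolve along the valuation DOWNSTAIRS».  Everything PROVED; no definitions, no named facts;
[folklore].  Nothing here proves resolution of singularities in positive characteristic or any statement of a manuscript under adjudication;
rung 0.  AI-written; AI review weaker than expert review.
[cite: CossartPiltant2008, proofs of Prop. 9.3 and Lemma 9.4 (HAL hal-00139124 pp. 27, 29)] [cite: CossartPiltant2019, proof of Prop. 4.10 (arXiv v1 Prop. 4.8, p. 54)]
-/

-- `Summit.<Summit>.<Sub>.Theorems` with `Sub = Summit` (single-conjunct summit, D-0017)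
set_option linter.dupNamespace false

noncomputable section

open IsLocalRing Polynomial
open Literature.AlgebraicGeometry.Resolution

namespace Summit.ResolutionOfSingularities.ResolutionOfSingularities.Theorems.RadicialJung.CleanModels.StabilityCriterion

universe u

variable {S E : Type u} [CommRing S] [Field E] [Algebra S E]

/-- **Units stay units inside the preserved subfield**: if `σ` maps `O_E ∩ M′` into `O_E` and `s ∈ M′` has `v(s) = 1`, then
`v(σ s) = 1` (apply the hypothesis to `s` and to `s⁻¹ ∈ M′`). [folklore] -/
theorem valuation_map_eq_one_of_mem_subfield (OE : ValuationSubring E) (M' : Subfield E) (σ : E ≃ₐ[S] E)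
    (hσO : ∀ x ∈ M', x ∈ OE → σ x ∈ OE) {s : E} (hsM : s ∈ M') (hs1 : OE.valuation s = 1) :
    OE.valuation (σ s) = 1 := by
  have hs0 : s ≠ 0 := ne_zero_of_valuation_eq_one hs1
  have hsO : s ∈ OE := by rw [← OE.valuation_le_one_iff, hs1]
  refine le_antisymm ((OE.valuation_le_one_iff _).mpr (hσO _ hsM hsO)) ?_
  have hsinv : s⁻¹ ∈ OE := by
    rw [← OE.valuation_le_one_iff, map_inv₀, hs1, inv_one]
  have h := (OE.valuation_le_one_iff _).mpr (hσO _ (M'.inv_mem hsM) hsinv)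
  rw [map_inv₀, map_inv₀, inv_le_one₀ ((Valuation.pos_iff _).mpr
    (fun e => hs0 (by simpa using congrArg σ.symm e)))] at h
  exact h

/-- **Stability criterion inside a preserved subfield.** `M′ ∋ S` a subfield, `σ` an `S`-automorphism of `E` mapping `O_E ∩ M′` into
`O_E`, `g ⊆ M′`; if `σ a ∈ locAtCentre S[g] O_E` for every `a ∈ g`, then `σ` maps `locAtCentre S[g] O_E` into itself
(`S[g] = (Algebra.adjoin S g).toSubring`).  As `locAtCentre_map_mem_of_generators` with the unit hypothesis discharged by
`valuation_map_eq_one_of_mem_subfield` (`S[g] ⊆ M′`). [folklore] [cite: CossartPiltant2008, proof of Lemma 9.4 (HAL p. 29), "S is stable by G"] -/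
theorem locAtCentre_map_mem_of_generators_of_subfield (OE : ValuationSubring E) (M' : Subfield E)
    (hSM : ∀ s : S, algebraMap S E s ∈ M') (σ : E ≃ₐ[S] E) (hσO : ∀ x ∈ M', x ∈ OE → σ x ∈ OE)
    {g : Set E} (hgM : g ⊆ M')
    (hg : ∀ a ∈ g, σ a ∈ locAtCentre (Algebra.adjoin S g).toSubring OE) :
    ∀ z ∈ locAtCentre (Algebra.adjoin S g).toSubring OE, σ z ∈ locAtCentre (Algebra.adjoin S g).toSubring OE := by
  have hCeq : (Algebra.adjoin S g).toSubring = Subring.closure (Set.range (algebraMap S E) ∪ g) :=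
    Algebra.adjoin_eq_ring_closure _
  have hCM : (Algebra.adjoin S g).toSubring ≤ M'.toSubring := by
    rw [hCeq]
    refine Subring.closure_le.mpr ?_
    rintro a (⟨s, rfl⟩ | ha)
    · exact hSM s
    · exact hgM ha
  -- `σ` maps `S[g]` into the local ring
  have hσC : ∀ c ∈ (Algebra.adjoin S g).toSubring,
      σ c ∈ locAtCentre (Algebra.adjoin S g).toSubring OE := by
    intro c hc
    rw [hCeq] at hc
    induction hc using Subring.closure_induction with
    | mem x hx =>
      rcases hx with ⟨s, rfl⟩ | hx
      · rw [AlgEquiv.commutes]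
        exact le_locAtCentre _ OE (Subalgebra.algebraMap_mem (Algebra.adjoin S g) s)
      · exact hg x hx
    | zero => rw [map_zero]; exact Subring.zero_mem _
    | one => rw [map_one]; exact Subring.one_mem _
    | add x y _ _ hx hy => rw [map_add]; exact Subring.add_mem _ hx hy
    | neg x _ hx => rw [map_neg]; exact Subring.neg_mem _ hx
    | mul x y _ _ hx hy => rw [map_mul]; exact Subring.mul_mem _ hx hy
  intro z hz
  obtain ⟨y, hy, s, hs, hsv, rfl⟩ := mem_locAtCentre_iff.mp hz
  rw [map_div₀, div_eq_mul_inv]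
  exact Subring.mul_mem _ (hσC y hy)
    (inv_mem_locAtCentre (hσC s hs) (valuation_map_eq_one_of_mem_subfield OE M' σ hσO (hCM hs) hsv))

/-- **Displacements of a finite set are finite**: for `S → E` injective and `E` algebraic over `S`, the elements `σ a − a`
(`σ ∈ Aut_S E`, `a ∈ t`) of a finite `t` lie in a finite set — `σ a` is a root of an annihilating polynomial of `a`. [folklore] -/
theorem exists_finset_displacements [Algebra.IsAlgebraic S E] (hinj : Function.Injective (algebraMap S E))
    (t : Finset E) : ∃ D : Finset E, ∀ (σ : E ≃ₐ[S] E), ∀ a ∈ t, σ a - a ∈ D := by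
  classical
  induction t using Finset.induction_on with
  | empty => exact ⟨∅, fun σ a ha => absurd ha (Finset.notMem_empty a)⟩
  | insert a t hat ih =>
    obtain ⟨D, hD⟩ := ih
    obtain ⟨p, hp0, hpa⟩ := Algebra.IsAlgebraic.isAlgebraic (R := S) a
    refine ⟨D ∪ ((p.aroots E).toFinset.image fun r => r - a), fun σ b hb => ?_⟩
    rcases Finset.mem_insert.mp hb with rfl | hb
    · refine Finset.mem_union_right _ (Finset.mem_image.mpr ⟨σ b, ?_, rfl⟩)
      rw [Multiset.mem_toFinset, Polynomial.mem_aroots']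
      exact ⟨(Polynomial.map_ne_zero_iff hinj).mpr hp0, by rw [Polynomial.aeval_algHom_apply, hpa, map_zero]⟩
    · exact Finset.mem_union_left _ (hD σ b hb)

/-- **Equivariant local uniformization from INVARIANT COFINALITY** (hand-1 g20 memo §2 (C1); the common content of the research leaves
`hEqT` / `hEqI` of `CleanModels` stub 2).  Frame as in the module docstring.  Hypotheses: a local uniformization of `M′` exists (`hLU`);
`e₀ ⊆ O_E ∩ M′` finite; INVARIANT COFINALITY (`hICof`): every local uniformization `t` of `M′` and every finite `e ⊆ O_E ∩ M′` admit a
local uniformization `t′ ⊇ t` of `M′` whose NEW generators are fixed by every `σ ∈ H` and whose local ring contains `e`.  Conclusion: a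
local uniformization of `M′` whose local ring is mapped into itself by every `σ ∈ H` and contains `e₀`.  Proof: apply `hICof` to a given
`t` and `e = e₀ ∪ {σ a − a : σ ∈ H, a ∈ t} ∩ (O_E ∩ M′)` (finite by `exists_finset_displacements`); in the resulting `t′` every generator
is either in `t` (displacement in the local ring) or fixed, so `locAtCentre_map_mem_of_generators_of_subfield` applies.
[folklore] [cite: CossartPiltant2008, proofs of Prop. 9.3 and Lemma 9.4 (HAL hal-00139124 pp. 27, 29)] -/
theorem exists_stableLU_of_invariantCofinality [Algebra.IsAlgebraic S E] (hinj : Function.Injective (algebraMap S E))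
    (OE : ValuationSubring E) (M' : Subfield E) (hSM : ∀ s : S, algebraMap S E s ∈ M')
    (H : Subgroup (E ≃ₐ[S] E)) (hHM : ∀ σ ∈ H, ∀ x ∈ M', σ x ∈ M') (hHO : ∀ σ ∈ H, ∀ x ∈ M', x ∈ OE → σ x ∈ OE)
    (hLU : ∃ t : Finset E, (t : Set E) ⊆ M' ∧
      M' ≤ Subfield.closure (Set.range (algebraMap S E) ∪ (t : Set E)) ∧
      ∃ hTO : (Algebra.adjoin S (t : Set E)).toSubring ≤ OE.toSubring,
        IsRegularLocalRing (Localization.AtPrime (Ideal.comap (Subring.inclusion hTO) (maximalIdeal OE))))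
    (e₀ : Finset E) (he₀M : (e₀ : Set E) ⊆ M') (he₀O : ∀ x ∈ e₀, x ∈ OE)
    (hICof : ∀ (t : Finset E), (t : Set E) ⊆ M' →
      M' ≤ Subfield.closure (Set.range (algebraMap S E) ∪ (t : Set E)) →
      (∃ hTO : (Algebra.adjoin S (t : Set E)).toSubring ≤ OE.toSubring,
        IsRegularLocalRing (Localization.AtPrime (Ideal.comap (Subring.inclusion hTO) (maximalIdeal OE)))) →
      ∀ (e : Finset E), (e : Set E) ⊆ M' → (∀ x ∈ e, x ∈ OE) →
      ∃ t' : Finset E, t ⊆ t' ∧ (t' : Set E) ⊆ M' ∧ (∀ σ ∈ H, ∀ x ∈ t', x ∉ t → σ x = x) ∧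
        ∃ hTO' : (Algebra.adjoin S (t' : Set E)).toSubring ≤ OE.toSubring,
          IsRegularLocalRing (Localization.AtPrime (Ideal.comap (Subring.inclusion hTO') (maximalIdeal OE))) ∧
          ∀ x ∈ e, x ∈ locAtCentre (Algebra.adjoin S (t' : Set E)).toSubring OE) :
    ∃ t : Finset E, (t : Set E) ⊆ M' ∧
      M' ≤ Subfield.closure (Set.range (algebraMap S E) ∪ (t : Set E)) ∧
      ∃ hTO : (Algebra.adjoin S (t : Set E)).toSubring ≤ OE.toSubring,
        IsRegularLocalRing (Localization.AtPrime (Ideal.comap (Subring.inclusion hTO) (maximalIdeal OE))) ∧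
        (∀ σ ∈ H, ∀ x ∈ locAtCentre (Algebra.adjoin S (t : Set E)).toSubring OE,
          σ x ∈ locAtCentre (Algebra.adjoin S (t : Set E)).toSubring OE) ∧
        (∀ x ∈ e₀, x ∈ locAtCentre (Algebra.adjoin S (t : Set E)).toSubring OE) := by
  classical
  obtain ⟨t, htM, hMt, hreg⟩ := hLU
  have hTO : (Algebra.adjoin S (t : Set E)).toSubring ≤ OE.toSubring := hreg.fst
  -- the finite set of displacements, cut down to `O_E ∩ M′`
  obtain ⟨D, hD⟩ := exists_finset_displacements (S := S) (E := E) hinj t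
  set e : Finset E := e₀ ∪ D.filter (fun x => x ∈ M' ∧ x ∈ OE) with he
  have heM : (e : Set E) ⊆ M' := by
    intro x hx
    rcases Finset.mem_union.mp (Finset.mem_coe.mp hx) with hx | hx
    · exact he₀M (Finset.mem_coe.mpr hx)
    · exact (Finset.mem_filter.mp hx).2.1
  have heO : ∀ x ∈ e, x ∈ OE := by
    intro x hx
    rcases Finset.mem_union.mp hx with hx | hx
    · exact he₀O x hx
    · exact (Finset.mem_filter.mp hx).2.2
  -- displacements of generators under `H` lie in `e`
  have hdisp : ∀ σ ∈ H, ∀ a ∈ t, σ a - a ∈ e := by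
    intro σ hσ a ha
    have haM : a ∈ M' := htM (Finset.mem_coe.mpr ha)
    have haO : a ∈ OE := hTO (Algebra.subset_adjoin (Finset.mem_coe.mpr ha))
    refine Finset.mem_union_right _ (Finset.mem_filter.mpr ⟨hD σ a ha, ?_, ?_⟩)
    · exact M'.sub_mem (hHM σ hσ a haM) haM
    · exact OE.sub_mem (hHO σ hσ a haM haO) haO
  obtain ⟨t', htt', ht'M, hfix, hTO', hreg', hecont⟩ := hICof t htM hMt hreg e heM heO
  refine ⟨t', ht'M, ?_, hTO', hreg', ?_, ?_⟩
  · refine hMt.trans (Subfield.closure_mono (Set.union_subset_union_right _ ?_))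
    exact Finset.coe_subset.mpr htt'
  · intro σ hσ
    refine locAtCentre_map_mem_of_generators_of_subfield OE M' hSM σ (hHO σ hσ) ht'M ?_
    intro a ha
    have ha' : a ∈ t' := Finset.mem_coe.mp ha
    by_cases hat : a ∈ t
    · have h : σ a = (σ a - a) + a := by ring
      rw [h]
      exact Subring.add_mem _ (hecont _ (hdisp σ hσ a hat))
        (le_locAtCentre _ OE (Algebra.subset_adjoin ha))
    · rw [hfix σ hσ a ha' hat]
      exact le_locAtCentre _ OE (Algebra.subset_adjoin ha)
  · intro x hx
    exact hecont x (Finset.mem_union_left _ hx)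

end Summit.ResolutionOfSingularities.ResolutionOfSingularities.Theorems.RadicialJung.CleanModels.StabilityCriterion

end
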